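import Literature.Geometry.Lorentzian.KerrTimeDominatedEstimate
import HarnessLib

/-!
# The weight `y = exp(−C∫χr⁻²)`, the cut-offs and the potential bounds of the bounded-frequency
# range `𝓖_♭` of Dafermos–Rodnianski–Shlapentokh-Rothman (§8.7.4): infrastructure

(family `gr`, infrastructure for statement **gr.S24**; namespace `Literature.Geometry.Lorentzian.Kerr`)

Dafermos–Rodnianski–Shlapentokh-Rothman (*Decay for solutions of the wave equation on Kerr exterior
spacetimes III*, arXiv:1402.7034 = Ann. of Math. 183 (2016)) treat the last of their frequency
ranges, the non-stationary bounded frequencies `(ω, m, Λ) ∈ 𝓖_♭(ω_high, ε_width)`, `|ω| ≥ ω_low`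
(§8.7.4, Proposition 8.7.4 — "It is only this range which gives rise to the term
`1_{…}|u(−∞)|²` on the right hand side of (fromPhaseSpace2) in the statement of Theorem 8.1"), with
the current `Q = ϟ^y − E·Q^T` for the weight `y(r*) = exp(−C ∫_{r*}^∞ χ_{R_∞} r⁻² dr*)`
("`C = C(ω_low, ω_high, ε_width)` sufficiently large … `y|_{r* ≥ R*_∞} = 1` and `y(−∞) = 0`") and a
smooth splitting `V = V_≤ + V_≥ = χ₂V + (1 − χ₂)V` of Carter's potential. This file supplies the
objects of that proof as explicit functions of `x = r*` along a tortoise radius function `R`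
(`KerrTortoiseRadius.lean`) and **proves** their elementary properties; the estimate itself is
`Kerr.flatNonStationary_estimate_kerr` (`KerrFlatNonStationaryEstimate.lean`).

* `Kerr.softStep` — a `C¹` piecewise-quadratic unit step `ψ` (`0` on `t ≤ 0`, `1` on `t ≥ 1`,
  `0 ≤ ψ' ≤ 2`), an explicit substitute for the smooth cut-offs of loc. cit. whose derivative bound
  `|χ₂'| ≤ B(R_∞ − R₆)⁻¹` is all that is used; `Kerr.radialCutoff c r = ψ(c − r)` (`1` on
  `r ≤ c − 1`, `0` on `r ≥ c`).
* `Kerr.nsWeightIntegrand`, `Kerr.nsWeight C c X R x = exp(−C ∫_x^X χ_c(R(s)) R(s)⁻² ds)` — the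
  weight (`X` any point with `R(X) ≥ c`, beyond which the integrand vanishes): `0 < y ≤ 1`,
  `y' = C χ_c(R) R⁻² y ≥ 0` (`Kerr.hasDerivAt_nsWeight`), `y = 1` on `x ≥ X`, `y → 1` at `+∞`,
  **`y → 0` at `−∞`** (`Kerr.tendsto_nsWeight_atBot`: below the cut-off the exponent exceeds
  `(s_b − x)/(c − 1)²`), and `y = y'R²/C` below the cut-off radius; `Kerr.nsWeightDeriv`,
  `Kerr.integrable_nsWeightDeriv` (`∫ y' = 1`).
* `Kerr.nsCutoff`, `Kerr.nsCutoffDeriv` — the splitting cut-off `k = χ₂(R)` (`χ₂ = χ_{R_a+1}`) and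
  its `r*`-derivative (`|k'| ≤ 2`, supported on `R_a < R < R_a + 1`).
* `Kerr.sepPotentialR`, `Kerr.sepPotentialRDeriv` — `V(R(x))` and `V' = (dV/dr)(R) Δ/(R² + a²)`
  as functions of `r*`; **`|V(R)| ≤ 3(Λ₁ + 1)/R²`** for admissible triples with `Λ ≤ Λ₁` (the
  bound "`|V| ≤ B(ω_high, ε_width)`", `Λ ≤ ε⁻¹_width ω²_high`, of loc. cit., from
  `KerrSeparatedPotentialBounds.abs_sepPotential_le`), `V' ≤ 0` beyond `7M` ((decrease)), and
  **`V'` is integrable on `ℝ`** (dominated by the derivative of the bounded monotone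
  `Φ ∘ R`, `Φ = Kerr.potDerivMajorant = −(12Λr⁻² + (184M/3)r⁻³)`, since
  `|dV/dr| ≤ 24Λ/r³ + 184M/r⁴`).
* Two lemmas on `ℝ`: a continuous function with `|u|²` convergent at `±∞` is bounded
  (`Kerr.exists_norm_le_of_tendsto_norm_sq`), and the integration by parts
  `∫ W'|u|² = −2∫ W Re(u'ū)` for `W|u|² → 0` at `±∞` (`Kerr.integral_deriv_mul_norm_sq_eq`; the step
  (absorbV1) of loc. cit.).

No named facts (D-0026); everything is proved.

## References

* M. Dafermos, I. Rodnianski, Y. Shlapentokh-Rothman, arXiv:1402.7034 = Ann. of Math. 183 (2016),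
  §5.2.3, §8.4 ((someBoundS), (decrease)), §8.7.4 (Prop. 8.7.4 and its proof: the weight `y`, the
  cut-offs `χ_{R_∞}`, `χ₂`, (absorbV1), (absorbV2)) (key `DafermosRodnianskiShlapentokhrothman2014`).
-/

noncomputable section

open scoped InnerProductSpace ComplexConjugate
open Filter Topology MeasureTheory Set

namespace Literature.Geometry.Lorentzian

namespace Kerr

/-! ### A `C¹` unit step with derivative bounded by `2` -/

/-- The **soft unit step** `ψ(t) = 2(max(t,0)² − 2max(t − ½,0)² + max(t − 1,0)²)`: a `C¹`,
piecewise quadratic, non-decreasing function with `ψ = 0` on `t ≤ 0`, `ψ = 1` on `t ≥ 1` and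
`0 ≤ ψ' ≤ 2` (an explicit substitute for the smooth cut-offs "identically `1` on … and identically
`0` on …, `|χ'| ≤ B(R_∞ − R₆)⁻¹`" of DRSR arXiv:1402.7034, §8.7.4). [folklore] -/
def softStep (t : ℝ) : ℝ :=
  2 * (max t 0 ^ 2 - 2 * max (t - 1 / 2) 0 ^ 2 + max (t - 1) 0 ^ 2)

/-- The derivative `ψ'(t) = 4(max(t,0) − 2max(t − ½,0) + max(t − 1,0))` of `softStep`. [folklore] -/
def softStepDeriv (t : ℝ) : ℝ :=
  4 * (max t 0 - 2 * max (t - 1 / 2) 0 + max (t - 1) 0)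

/-- `ψ' ` is the derivative of `ψ`. [folklore] -/
theorem hasDerivAt_softStep (t : ℝ) : HasDerivAt softStep (softStepDeriv t) t := by
  have h0 := hasDerivAt_max_zero_sq t
  have h1 : HasDerivAt (fun s : ℝ ↦ max (s - 1 / 2) 0 ^ 2) (2 * max (t - 1 / 2) 0) t := by
    have h := (hasDerivAt_max_zero_sq (t - 1 / 2)).comp t ((hasDerivAt_id t).sub_const (1 / 2))
    simpa [Function.comp_def] using h
  have h2 : HasDerivAt (fun s : ℝ ↦ max (s - 1) 0 ^ 2) (2 * max (t - 1) 0) t := by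
    have h := (hasDerivAt_max_zero_sq (t - 1)).comp t ((hasDerivAt_id t).sub_const 1)
    simpa [Function.comp_def] using h
  have h := ((h0.sub (h1.const_mul 2)).add h2).const_mul 2
  refine h.congr_deriv ?_
  unfold softStepDeriv
  ring

/-- `ψ = 0` on `t ≤ 0`. [folklore] -/
theorem softStep_of_nonpos {t : ℝ} (ht : t ≤ 0) : softStep t = 0 := by
  unfold softStep
  rw [max_eq_right ht, max_eq_right (by linarith), max_eq_right (by linarith)]
  ring

/-- `ψ = 1` on `t ≥ 1`. [folklore] -/
theorem softStep_of_one_le {t : ℝ} (ht : 1 ≤ t) : softStep t = 1 := by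
  unfold softStep
  rw [max_eq_left (by linarith), max_eq_left (by linarith), max_eq_left (by linarith)]
  ring

/-- `ψ' = 0` on `t ≤ 0`. [folklore] -/
theorem softStepDeriv_of_nonpos {t : ℝ} (ht : t ≤ 0) : softStepDeriv t = 0 := by
  unfold softStepDeriv
  rw [max_eq_right ht, max_eq_right (by linarith), max_eq_right (by linarith)]
  ring

/-- `ψ' = 0` on `t ≥ 1`. [folklore] -/
theorem softStepDeriv_of_one_le {t : ℝ} (ht : 1 ≤ t) : softStepDeriv t = 0 := by
  unfold softStepDeriv
  rw [max_eq_left (by linarith), max_eq_left (by linarith), max_eq_left (by linarith)]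
  ring

/-- `0 ≤ ψ' ≤ 2`. [folklore] -/
theorem softStepDeriv_mem_Icc (t : ℝ) : softStepDeriv t ∈ Icc 0 2 := by
  unfold softStepDeriv
  rcases le_or_gt t 0 with h0 | h0
  · rw [max_eq_right h0, max_eq_right (by linarith), max_eq_right (by linarith)]
    norm_num
  rcases le_or_gt t (1 / 2) with h1 | h1
  · rw [max_eq_left h0.le, max_eq_right (by linarith), max_eq_right (by linarith)]
    constructor <;> nlinarith
  rcases le_or_gt t 1 with h2 | h2
  · rw [max_eq_left h0.le, max_eq_left (by linarith), max_eq_right (by linarith)]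
    constructor <;> nlinarith
  · rw [max_eq_left h0.le, max_eq_left (by linarith), max_eq_left (by linarith)]
    constructor <;> linarith

/-- `|ψ'| ≤ 2`. [folklore] -/
theorem abs_softStepDeriv_le (t : ℝ) : |softStepDeriv t| ≤ 2 := by
  have h := softStepDeriv_mem_Icc t
  rw [abs_le]
  exact ⟨by linarith [h.1], h.2⟩

/-- `ψ` is non-decreasing. [folklore] -/
theorem monotone_softStep : Monotone softStep :=
  monotone_of_deriv_nonneg (fun t ↦ (hasDerivAt_softStep t).differentiableAt) fun t ↦ by
    rw [(hasDerivAt_softStep t).deriv]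
    exact (softStepDeriv_mem_Icc t).1

/-- `0 ≤ ψ ≤ 1`. [folklore] -/
theorem softStep_mem_Icc (t : ℝ) : softStep t ∈ Icc 0 1 := by
  constructor
  · rcases le_or_gt t 0 with h | h
    · rw [softStep_of_nonpos h]
    · rw [← softStep_of_nonpos le_rfl]
      exact monotone_softStep h.le
  · rcases le_or_gt 1 t with h | h
    · rw [softStep_of_one_le h]
    · rw [← softStep_of_one_le le_rfl]
      exact monotone_softStep h.le

/-- `ψ` is continuous. [folklore] -/
theorem continuous_softStep : Continuous softStep :=
  continuous_iff_continuousAt.2 fun t ↦ (hasDerivAt_softStep t).continuousAt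

/-- `ψ'` is continuous. [folklore] -/
theorem continuous_softStepDeriv : Continuous softStepDeriv := by
  unfold softStepDeriv
  fun_prop


/-! ### Radial cut-offs `χ_c(r) = ψ(c − r)` -/

/-- The **radial cut-off** `χ_c(r) = ψ(c − r)`: `1` for `r ≤ c − 1`, `0` for `r ≥ c`, `C¹` in `r`
with `|dχ_c/dr| ≤ 2` and values in `[0, 1]` (the cut-offs `χ_{R_∞}` and `χ₂` of DRSR
arXiv:1402.7034, §8.7.4, with unit transition length). [cite: DafermosRodnianskiShlapentokhrothman2014, Prop. 8.7.4 (proof)] -/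
def radialCutoff (c r : ℝ) : ℝ :=
  softStep (c - r)

/-- `χ_c = 1` on `r ≤ c − 1`. [folklore] -/
theorem radialCutoff_of_le {c r : ℝ} (h : r ≤ c - 1) : radialCutoff c r = 1 :=
  softStep_of_one_le (by linarith)

/-- `χ_c = 0` on `r ≥ c`. [folklore] -/
theorem radialCutoff_of_ge {c r : ℝ} (h : c ≤ r) : radialCutoff c r = 0 :=
  softStep_of_nonpos (by linarith)

/-- `0 ≤ χ_c ≤ 1`. [folklore] -/
theorem radialCutoff_mem_Icc (c r : ℝ) : radialCutoff c r ∈ Icc 0 1 :=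
  softStep_mem_Icc _

/-- `dχ_c/dr = −ψ'(c − r)`. [folklore] -/
theorem hasDerivAt_radialCutoff (c r : ℝ) :
    HasDerivAt (radialCutoff c) (-softStepDeriv (c - r)) r := by
  have h := (hasDerivAt_softStep (c - r)).comp r ((hasDerivAt_const r c).sub (hasDerivAt_id r))
  have h' : HasDerivAt (softStep ∘ fun s ↦ c - id s) (softStepDeriv (c - r) * (0 - 1)) r := h
  refine (h'.congr_deriv (by ring)).congr_of_eventuallyEq (Eventually.of_forall fun s ↦ ?_)
  simp [radialCutoff]

/-- `|dχ_c/dr| ≤ 2`. [folklore] -/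
theorem abs_deriv_radialCutoff_le (c r : ℝ) : |(-softStepDeriv (c - r))| ≤ 2 := by
  rw [abs_neg]
  exact abs_softStepDeriv_le _

/-- `dχ_c/dr = 0` off `[c − 1, c]`. [folklore] -/
theorem softStepDeriv_sub_eq_zero {c r : ℝ} (h : r ≤ c - 1 ∨ c ≤ r) : softStepDeriv (c - r) = 0 := by
  rcases h with h | h
  · exact softStepDeriv_of_one_le (by linarith)
  · exact softStepDeriv_of_nonpos (by linarith)

/-- `χ_c` is continuous. [folklore] -/
theorem continuous_radialCutoff (c : ℝ) : Continuous (radialCutoff c) :=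
  continuous_softStep.comp (continuous_const.sub continuous_id)

/-! ### The weight `y = exp(−C ∫_{r*}^{∞} χ_c(r) r⁻² dr*)` of the non-stationary bounded range -/

/-- The integrand `g(s) = χ_c(R(s))/R(s)²` of the exponent of the weight `y` (a function of
`s = r*`, `R` a tortoise radius function). DRSR arXiv:1402.7034, §8.7.4
(`y = exp(−C∫_{r*}^∞ χ_{R_∞} r⁻² dr*)`). [cite: DafermosRodnianskiShlapentokhrothman2014, Prop. 8.7.4 (proof)] -/
def nsWeightIntegrand (c : ℝ) (R : ℝ → ℝ) (s : ℝ) : ℝ :=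
  radialCutoff c (R s) / R s ^ 2

/-- **The weight `y(x) = exp(−C ∫_x^X g(s) ds)`** of DRSR arXiv:1402.7034, Prop. 8.7.4, with
`g = χ_c(R)/R²`; here `X` is any point with `R(X) ≥ c` (beyond it `g = 0`, so the value does not
depend on `X`, and `y = 1` on `x ≥ X`), `C > 0` the large constant of loc. cit. and `c = R_∞`.
[cite: DafermosRodnianskiShlapentokhrothman2014, Prop. 8.7.4 (proof)] -/
def nsWeight (C c X : ℝ) (R : ℝ → ℝ) (x : ℝ) : ℝ :=
  Real.exp (-(C * ∫ s in x..X, nsWeightIntegrand c R s))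

section WeightLemmas

variable {M a C c X : ℝ} {R : ℝ → ℝ}

/-- `g` is continuous (for a tortoise radius function, `R > 0`). [folklore] -/
theorem continuous_nsWeightIntegrand (hR : IsTortoiseRadius M a R) (hMa : IsSubextremal M a) :
    Continuous (nsWeightIntegrand c R) := by
  unfold nsWeightIntegrand
  refine ((continuous_radialCutoff c).comp hR.continuous).div (hR.continuous.pow 2) fun s ↦ ?_
  exact (pow_pos (hR.pos hMa s) 2).ne'

/-- `0 ≤ g ≤ 1/R²`. [folklore] -/
theorem nsWeightIntegrand_mem_Icc (hR : IsTortoiseRadius M a R) (hMa : IsSubextremal M a) (s : ℝ) :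
    nsWeightIntegrand c R s ∈ Icc 0 (1 / R s ^ 2) := by
  have h := radialCutoff_mem_Icc c (R s)
  have hR2 : 0 < R s ^ 2 := pow_pos (hR.pos hMa s) 2
  unfold nsWeightIntegrand
  exact ⟨div_nonneg h.1 hR2.le, div_le_div_of_nonneg_right h.2 hR2.le⟩

/-- `g = 0` where `R ≥ c`. [folklore] -/
theorem nsWeightIntegrand_of_ge {s : ℝ} (h : c ≤ R s) : nsWeightIntegrand c R s = 0 := by
  simp [nsWeightIntegrand, radialCutoff_of_ge h]

/-- `g = 1/R²` where `R ≤ c − 1`. [folklore] -/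
theorem nsWeightIntegrand_of_le {s : ℝ} (h : R s ≤ c - 1) : nsWeightIntegrand c R s = 1 / R s ^ 2 := by
  simp [nsWeightIntegrand, radialCutoff_of_le h]

/-- **`y' = C g y`.** [cite: DafermosRodnianskiShlapentokhrothman2014, Prop. 8.7.4 (proof)] -/
theorem hasDerivAt_nsWeight (hR : IsTortoiseRadius M a R) (hMa : IsSubextremal M a) (x : ℝ) :
    HasDerivAt (nsWeight C c X R) (C * nsWeightIntegrand c R x * nsWeight C c X R x) x := by
  have hg := continuous_nsWeightIntegrand (c := c) hR hMa
  have hI : HasDerivAt (fun t ↦ ∫ s in t..X, nsWeightIntegrand c R s) (-nsWeightIntegrand c R x) x :=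
    intervalIntegral.integral_hasDerivAt_left (hg.intervalIntegrable _ _)
      (hg.stronglyMeasurableAtFilter _ _) hg.continuousAt
  have h := (Real.hasDerivAt_exp _).comp x ((hI.const_mul C).neg)
  refine h.congr_deriv ?_
  simp only [nsWeight, Pi.neg_apply, mul_neg, neg_neg]
  ring

/-- `y > 0`. [folklore] -/
theorem nsWeight_pos (C c X : ℝ) (R : ℝ → ℝ) (x : ℝ) : 0 < nsWeight C c X R x :=
  Real.exp_pos _

/-- The exponent is non-negative: `∫_x^X g ≥ 0` (for `R(X) ≥ c`, whatever the order of `x`, `X`).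
[folklore] -/
theorem nsWeight_exponent_nonneg (hR : IsTortoiseRadius M a R) (hMa : IsSubextremal M a)
    (hX : c ≤ R X) (x : ℝ) : 0 ≤ ∫ s in x..X, nsWeightIntegrand c R s := by
  rcases le_or_gt x X with hx | hx
  · exact intervalIntegral.integral_nonneg hx fun s _ ↦ (nsWeightIntegrand_mem_Icc hR hMa s).1
  · -- beyond `X` the integrand vanishes
    have h0 : ∫ s in X..x, nsWeightIntegrand c R s = 0 := by
      rw [intervalIntegral.integral_congr (g := fun _ ↦ (0 : ℝ)) ?_]
      · exact intervalIntegral.integral_zero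
      · intro s hs
        rw [uIcc_of_le hx.le] at hs
        exact nsWeightIntegrand_of_ge (hX.trans ((hR.strictMono hMa).monotone hs.1))
    rw [intervalIntegral.integral_symm, h0, neg_zero]

/-- `y ≤ 1`. [cite: DafermosRodnianskiShlapentokhrothman2014, Prop. 8.7.4 (`|y| ≤ B`)] -/
theorem nsWeight_le_one (hR : IsTortoiseRadius M a R) (hMa : IsSubextremal M a) (hC : 0 ≤ C)
    (hX : c ≤ R X) (x : ℝ) : nsWeight C c X R x ≤ 1 := by
  unfold nsWeight
  rw [Real.exp_le_one_iff, neg_nonpos]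
  exact mul_nonneg hC (nsWeight_exponent_nonneg hR hMa hX x)

/-- **`y = 1` for `x ≥ X`** (i.e. for `r* ≥ R*_∞`). [cite: DafermosRodnianskiShlapentokhrothman2014, Prop. 8.7.4 (`y = 1` for `r* ≥ R*_∞`)] -/
theorem nsWeight_eq_one (hR : IsTortoiseRadius M a R) (hMa : IsSubextremal M a) (hX : c ≤ R X)
    {x : ℝ} (hx : X ≤ x) : nsWeight C c X R x = 1 := by
  unfold nsWeight
  have h0 : ∫ s in x..X, nsWeightIntegrand c R s = 0 := by
    rw [intervalIntegral.integral_symm]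
    rw [intervalIntegral.integral_congr (g := fun _ ↦ (0 : ℝ)) ?_]
    · simp
    · intro s hs
      rw [uIcc_of_le hx] at hs
      exact nsWeightIntegrand_of_ge (hX.trans ((hR.strictMono hMa).monotone hs.1))
  rw [h0, mul_zero, neg_zero, Real.exp_zero]

/-- `y → 1` at `+∞`. [folklore] -/
theorem tendsto_nsWeight_atTop (hR : IsTortoiseRadius M a R) (hMa : IsSubextremal M a)
    (hX : c ≤ R X) : Tendsto (nsWeight C c X R) atTop (𝓝 1) := by
  apply tendsto_const_nhds.congr'
  filter_upwards [eventually_ge_atTop X] with x hx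
  exact (nsWeight_eq_one hR hMa hX hx).symm

/-- `y' ≥ 0`: the weight is non-decreasing (for `C ≥ 0`). [folklore] -/
theorem monotone_nsWeight (hR : IsTortoiseRadius M a R) (hMa : IsSubextremal M a) (hC : 0 ≤ C) :
    Monotone (nsWeight C c X R) :=
  monotone_of_deriv_nonneg (fun x ↦ (hasDerivAt_nsWeight hR hMa x).differentiableAt) fun x ↦ by
    rw [(hasDerivAt_nsWeight (C := C) (c := c) (X := X) hR hMa x).deriv]
    exact mul_nonneg (mul_nonneg hC (nsWeightIntegrand_mem_Icc hR hMa x).1) (nsWeight_pos _ _ _ _ _).le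

/-- **`y → 0` at the horizon** (`x → −∞`), for `C > 0` and `c − 1 > r₊`: below the cut-off the
exponent is `≥ (s_b − x)/(c − 1)² → ∞`. [cite: DafermosRodnianskiShlapentokhrothman2014, Prop. 8.7.4 (`y(−∞) = 0`)] -/
theorem tendsto_nsWeight_atBot (hR : IsTortoiseRadius M a R) (hMa : IsSubextremal M a) (hC : 0 < C)
    (hc : rPlus M a < c - 1) : Tendsto (nsWeight C c X R) atBot (𝓝 0) := by
  -- a point `s_b ≤ X` below which `R ≤ c − 1`
  obtain ⟨s₀, hs₀⟩ : ∃ s₀, ∀ s ≤ s₀, R s < c - 1 :=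
    eventually_atBot.1 (hR.tendsto_atBot.eventually (gt_mem_nhds hc))
  set sb := min s₀ X with hsb
  have hsbX : sb ≤ X := min_le_right _ _
  have hRle : ∀ s ≤ sb, R s ≤ c - 1 := fun s hs ↦ (hs₀ s (hs.trans (min_le_left _ _))).le
  have hc0 : 0 < c - 1 := (hMa.pos.trans_le (M_le_rPlus M a)).trans hc
  have hg := continuous_nsWeightIntegrand (c := c) hR hMa
  -- lower bound for the exponent on `x ≤ sb`
  have hlow : ∀ x ≤ sb, (sb - x) / (c - 1) ^ 2 ≤ ∫ s in x..X, nsWeightIntegrand c R s := by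
    intro x hx
    rw [← intervalIntegral.integral_add_adjacent_intervals (b := sb) (hg.intervalIntegrable _ _)
      (hg.intervalIntegrable _ _)]
    have h1 : (sb - x) / (c - 1) ^ 2 ≤ ∫ s in x..sb, nsWeightIntegrand c R s := by
      have hconst : ∫ _ in x..sb, (1 / (c - 1) ^ 2 : ℝ) = (sb - x) / (c - 1) ^ 2 := by
        rw [intervalIntegral.integral_const, smul_eq_mul]
        ring
      rw [← hconst]
      refine intervalIntegral.integral_mono_on hx intervalIntegrable_const (hg.intervalIntegrable _ _)
        fun s hs ↦ ?_
      rw [nsWeightIntegrand_of_le (hRle s hs.2)]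
      have hRs : 0 < R s := hR.pos hMa s
      exact one_div_le_one_div_of_le (pow_pos hRs 2) (pow_le_pow_left₀ hRs.le (hRle s hs.2) 2)
    have h2 : 0 ≤ ∫ s in sb..X, nsWeightIntegrand c R s :=
      intervalIntegral.integral_nonneg hsbX fun s _ ↦ (nsWeightIntegrand_mem_Icc hR hMa s).1
    linarith
  -- squeeze `0 < y ≤ exp(−C (sb − x)/(c − 1)²) → 0`
  have hlin : Tendsto (fun x ↦ -(C * ((sb - x) / (c - 1) ^ 2))) atBot atBot := by
    have h1 : Tendsto (fun x ↦ sb + -x) atBot atTop :=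
      tendsto_atTop_add_const_left _ sb tendsto_neg_atBot_atTop
    have h2 : Tendsto (fun x ↦ (sb + -x) * (C / (c - 1) ^ 2)) atBot atTop :=
      h1.atTop_mul_const (div_pos hC (pow_pos hc0 2))
    have h3 := tendsto_neg_atTop_atBot.comp h2
    refine h3.congr fun x ↦ ?_
    simp only [Function.comp_def]
    ring
  have hexp : Tendsto (fun x ↦ Real.exp (-(C * ((sb - x) / (c - 1) ^ 2)))) atBot (𝓝 0) :=
    Real.tendsto_exp_atBot.comp hlin
  refine tendsto_of_tendsto_of_tendsto_of_le_of_le' tendsto_const_nhds hexp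
    (Eventually.of_forall fun x ↦ (nsWeight_pos C c X R x).le) ?_
  filter_upwards [eventually_le_atBot sb] with x hx
  unfold nsWeight
  rw [Real.exp_le_exp, neg_le_neg_iff]
  exact mul_le_mul_of_nonneg_left (hlow x hx) hC.le

/-- **Below the cut-off, `y' = C y/R²`** (`R(x) ≤ c − 1`). [cite: DafermosRodnianskiShlapentokhrothman2014, Prop. 8.7.4 (proof)] -/
theorem nsWeight_deriv_of_le {x : ℝ} (h : R x ≤ c - 1) :
    C * nsWeightIntegrand c R x * nsWeight C c X R x = C * nsWeight C c X R x / R x ^ 2 := by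
  rw [nsWeightIntegrand_of_le h]
  ring

/-- `y` is continuous. [folklore] -/
theorem continuous_nsWeight (hR : IsTortoiseRadius M a R) (hMa : IsSubextremal M a) :
    Continuous (nsWeight C c X R) :=
  continuous_iff_continuousAt.2 fun x ↦ (hasDerivAt_nsWeight hR hMa x).continuousAt

end WeightLemmas

/-! ### Two lemmas of real analysis on `ℝ` -/

section RealLine

variable {u u₁ : ℝ → ℂ} {A B : ℝ}

/-- A continuous function on `ℝ` whose squared modulus converges at `±∞` is bounded. [folklore] -/
theorem exists_norm_le_of_tendsto_norm_sq (hu : Continuous u)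
    (htop : Tendsto (fun x ↦ ‖u x‖ ^ 2) atTop (𝓝 A)) (hbot : Tendsto (fun x ↦ ‖u x‖ ^ 2) atBot (𝓝 B)) :
    ∃ K, ∀ x, ‖u x‖ ≤ K := by
  obtain ⟨b₁, hb₁⟩ := (isBoundedUnder_norm_of_tendsto_norm_sq htop)
  obtain ⟨b₂, hb₂⟩ := (isBoundedUnder_norm_of_tendsto_norm_sq hbot)
  rw [Filter.eventually_map] at hb₁ hb₂
  obtain ⟨T₁, hT₁⟩ := eventually_atTop.1 hb₁
  obtain ⟨T₂, hT₂⟩ := eventually_atBot.1 hb₂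
  obtain ⟨b₃, hb₃⟩ := (isCompact_Icc (a := T₂) (b := T₁)).exists_bound_of_continuousOn hu.continuousOn
  refine ⟨max b₁ (max b₂ b₃), fun x ↦ ?_⟩
  rcases le_or_gt T₁ x with h₁ | h₁
  · exact (hT₁ x h₁).trans (le_max_left _ _)
  rcases le_or_gt x T₂ with h₂ | h₂
  · exact (hT₂ x h₂).trans ((le_max_left _ _).trans (le_max_right _ _))
  · exact (hb₃ x ⟨h₂.le, h₁.le⟩).trans ((le_max_right _ _).trans (le_max_right _ _))

/-- **Integration by parts against `|u|²` on `ℝ`**: if `W` is `C¹` with `W|u|² → 0` at `±∞` and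
both `W'|u|²` and `W Re(u'ū)` are integrable, then `∫ W'|u|² = −2 ∫ W Re(u'ū)`
(`Re(u'ū) = ⟪u, u'⟫_ℝ`). The step `∫ (yV_≤)'|u|² = −2∫ yV_≤ Re(u'ū)` of DRSR arXiv:1402.7034,
§8.7.4 (absorbV1). [cite: DafermosRodnianskiShlapentokhrothman2014, Prop. 8.7.4 (proof, (absorbV1))] -/
theorem integral_deriv_mul_norm_sq_eq {W W₁ : ℝ → ℝ} (hW : ∀ x, HasDerivAt W (W₁ x) x)
    (hu : ∀ x, HasDerivAt u (u₁ x) x)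
    (hI₁ : Integrable fun x ↦ W₁ x * ‖u x‖ ^ 2) (hI₂ : Integrable fun x ↦ W x * ⟪u x, u₁ x⟫_ℝ)
    (hbot : Tendsto (fun x ↦ W x * ‖u x‖ ^ 2) atBot (𝓝 0))
    (htop : Tendsto (fun x ↦ W x * ‖u x‖ ^ 2) atTop (𝓝 0)) :
    ∫ x, W₁ x * ‖u x‖ ^ 2 = -2 * ∫ x, W x * ⟪u x, u₁ x⟫_ℝ := by
  have hderiv : ∀ x, HasDerivAt (fun t ↦ W t * ‖u t‖ ^ 2)
      (W₁ x * ‖u x‖ ^ 2 + 2 * (W x * ⟪u x, u₁ x⟫_ℝ)) x := fun x ↦ by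
    have h := (hW x).mul ((hu x).norm_sq)
    refine h.congr_deriv ?_
    ring
  have hint : Integrable fun x ↦ W₁ x * ‖u x‖ ^ 2 + 2 * (W x * ⟪u x, u₁ x⟫_ℝ) :=
    hI₁.add (hI₂.const_mul 2)
  have h := integral_of_hasDerivAt_of_tendsto hderiv hint hbot htop
  rw [sub_zero, integral_add hI₁ (hI₂.const_mul 2), integral_const_mul] at h
  linarith

end RealLine

/-! ### Carter's potential along a tortoise radius function: bounds and integrability -/

section PotentialAlongR

variable {M a ω Λ Λ₁ : ℝ} {m : ℤ} {R : ℝ → ℝ}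

/-- `dR/dx = Δ/(R² + a²) ≤ 1` (`Δ = R² − 2MR + a² ≤ R² + a²` for `M, R ≥ 0`). [folklore] -/
theorem IsTortoiseRadius.deriv_le_one (hR : IsTortoiseRadius M a R) (hMa : IsSubextremal M a)
    (x : ℝ) : delta M a (R x) / (R x ^ 2 + a ^ 2) ≤ 1 := by
  rw [div_le_one (hR.sq_add_sq_pos hMa x)]
  unfold delta
  nlinarith [hMa.pos, hR.pos hMa x]

/-- **`|V(R)| ≤ 3(Λ₁ + 1)/R²`** for an admissible triple with `Λ ≤ Λ₁` (from
`|V| ≤ 3Λ/r² + 3M/r³` and `M ≤ r`): the bound "`|V| ≤ B(ω_high, ε_width)`", `Λ ≤ ε⁻¹_width ω²_high`,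
of DRSR arXiv:1402.7034, §8.7.4, with its `r`-decay kept. [cite: DafermosRodnianskiShlapentokhrothman2014, Prop. 8.7.4 (proof)] -/
theorem abs_sepPotential_comp_le (hR : IsTortoiseRadius M a R) (hMa : IsSubextremal M a)
    (hadm : IsAdmissibleTriple a ω m Λ) (hΛ : Λ ≤ Λ₁) (x : ℝ) :
    |sepPotential M a ω m Λ (R x)| ≤ 3 * (Λ₁ + 1) / R x ^ 2 := by
  have hM := hMa.pos
  have hr : rPlus M a ≤ R x := (hR.rPlus_lt x).le
  have hMr : M ≤ R x := (M_le_rPlus M a).trans hr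
  have hr0 : 0 < R x := hR.pos hMa x
  have h := abs_sepPotential_le hM (le_of_lt hMa) hadm hr
  have h1 : 3 * Λ / R x ^ 2 ≤ 3 * Λ₁ / R x ^ 2 :=
    div_le_div_of_nonneg_right (by linarith) (by positivity)
  have h2 : 3 * M / R x ^ 3 ≤ 3 / R x ^ 2 := by
    rw [div_le_div_iff₀ (by positivity) (by positivity)]
    nlinarith [pow_pos hr0 2]
  have h3 : 3 * Λ₁ / R x ^ 2 + 3 / R x ^ 2 = 3 * (Λ₁ + 1) / R x ^ 2 := by ring
  linarith

/-- The global bound `|V(R)| ≤ 3(Λ₁ + 1)/M²` (as `R ≥ r₊ ≥ M`). [folklore] -/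
theorem abs_sepPotential_comp_le_const (hR : IsTortoiseRadius M a R) (hMa : IsSubextremal M a)
    (hadm : IsAdmissibleTriple a ω m Λ) (hΛ : Λ ≤ Λ₁) (x : ℝ) :
    |sepPotential M a ω m Λ (R x)| ≤ 3 * (Λ₁ + 1) / M ^ 2 := by
  have hM := hMa.pos
  have hΛ₁ : 0 ≤ Λ₁ := hadm.nonneg.trans hΛ
  have hMr : M ≤ R x := (M_le_rPlus M a).trans (hR.rPlus_lt x).le
  refine (abs_sepPotential_comp_le hR hMa hadm hΛ x).trans ?_
  exact div_le_div_of_nonneg_left (by positivity) (by positivity) (pow_le_pow_left₀ hM.le hMr 2)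

/-- Beyond `7M` the potential decreases along `r*`: `V' = (dV/dr)(R) · Δ/(R² + a²) ≤ 0` where
`R ≥ 7M` ((decrease) of DRSR arXiv:1402.7034, §8.4, used in §8.7.4 as "`V' < 0` for sufficiently
large `r*`"). [cite: DafermosRodnianskiShlapentokhrothman2014, Prop. 8.7.4 (proof)] -/
theorem deriv_sepPotential_comp_nonpos (hR : IsTortoiseRadius M a R) (hMa : IsSubextremal M a)
    (hadm : IsAdmissibleTriple a ω m Λ) {x : ℝ} (hx : 7 * M ≤ R x) :
    deriv (sepPotential M a ω m Λ) (R x) * (delta M a (R x) / (R x ^ 2 + a ^ 2)) ≤ 0 :=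
  mul_nonpos_of_nonpos_of_nonneg (deriv_sepPotential_neg_of_seven_mul_le hMa hadm hx).le
    (hR.deriv_pos hMa x).le

/-- The dominating primitive `Φ(r) = −(12Λ r⁻² + (184M/3) r⁻³)`, whose `r`-derivative
`24Λ/r³ + 184M/r⁴` bounds `|dV/dr|` (`KerrSeparatedPotentialBounds.abs_deriv_sepPotential_le`).
[folklore] -/
def potDerivMajorant (M Λ r : ℝ) : ℝ :=
  -(12 * Λ * (r ^ 2)⁻¹ + 184 * M / 3 * (r ^ 3)⁻¹)

/-- `dΦ/dr = 24Λ/r³ + 184M/r⁴` for `r ≠ 0`. [folklore] -/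
theorem hasDerivAt_potDerivMajorant (M Λ : ℝ) {r : ℝ} (hr : r ≠ 0) :
    HasDerivAt (potDerivMajorant M Λ) (24 * Λ / r ^ 3 + 184 * M / r ^ 4) r := by
  have h2 : HasDerivAt (fun s : ℝ ↦ (s ^ 2)⁻¹) (-(↑2 * r ^ (2 - 1)) / (r ^ 2) ^ 2) r :=
    (hasDerivAt_pow 2 r).inv (pow_ne_zero 2 hr)
  have h3 : HasDerivAt (fun s : ℝ ↦ (s ^ 3)⁻¹) (-(↑3 * r ^ (3 - 1)) / (r ^ 3) ^ 2) r :=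
    (hasDerivAt_pow 3 r).inv (pow_ne_zero 3 hr)
  have h := ((h2.const_mul (12 * Λ)).add (h3.const_mul (184 * M / 3))).neg
  refine h.congr_deriv ?_
  norm_num
  field_simp
  ring

/-- `Φ` is continuous at every `r ≠ 0`. [folklore] -/
theorem continuousAt_potDerivMajorant (M Λ : ℝ) {r : ℝ} (hr : r ≠ 0) :
    ContinuousAt (potDerivMajorant M Λ) r :=
  (hasDerivAt_potDerivMajorant M Λ hr).continuousAt

/-- `Φ(r) → 0` as `r → ∞`. [folklore] -/
theorem tendsto_potDerivMajorant_atTop (M Λ : ℝ) :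
    Tendsto (potDerivMajorant M Λ) atTop (𝓝 0) := by
  have h2 : Tendsto (fun r : ℝ ↦ (r ^ 2)⁻¹) atTop (𝓝 0) :=
    tendsto_inv_atTop_zero.comp (tendsto_pow_atTop two_ne_zero)
  have h3 : Tendsto (fun r : ℝ ↦ (r ^ 3)⁻¹) atTop (𝓝 0) :=
    tendsto_inv_atTop_zero.comp (tendsto_pow_atTop three_ne_zero)
  have h := ((h2.const_mul (12 * Λ)).add (h3.const_mul (184 * M / 3))).neg
  rw [mul_zero, mul_zero, add_zero, neg_zero] at h
  exact h

/-- Along a tortoise radius function, `x ↦ Φ(R(x))` has derivative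
`(24Λ/R³ + 184M/R⁴) · Δ/(R² + a²)`. [folklore] -/
theorem hasDerivAt_potDerivMajorant_comp (hR : IsTortoiseRadius M a R) (hMa : IsSubextremal M a)
    (x : ℝ) :
    HasDerivAt (fun t ↦ potDerivMajorant M Λ (R t))
      ((24 * Λ / R x ^ 3 + 184 * M / R x ^ 4) * (delta M a (R x) / (R x ^ 2 + a ^ 2))) x :=
  (hasDerivAt_potDerivMajorant M Λ (hR.pos hMa x).ne').comp x (hR.hasDerivAt x)

/-- The dominating derivative `(24Λ/R³ + 184M/R⁴) Δ/(R² + a²)` is integrable on `ℝ` (it is the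
non-negative derivative of the bounded monotone `Φ ∘ R`, which tends to `Φ(r₊)` at `−∞` and to `0`
at `+∞`). [folklore] -/
theorem integrable_potDerivMajorant_deriv (hR : IsTortoiseRadius M a R) (hMa : IsSubextremal M a)
    (hΛ : 0 ≤ Λ) :
    Integrable fun x ↦ (24 * Λ / R x ^ 3 + 184 * M / R x ^ 4) * (delta M a (R x) / (R x ^ 2 + a ^ 2)) := by
  have hM := hMa.pos
  have hderiv : ∀ x, HasDerivAt (fun t ↦ potDerivMajorant M Λ (R t))
      ((24 * Λ / R x ^ 3 + 184 * M / R x ^ 4) * (delta M a (R x) / (R x ^ 2 + a ^ 2)) + 0) x :=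
    fun x ↦ (hasDerivAt_potDerivMajorant_comp hR hMa x).congr_deriv (add_zero _).symm
  have hp : ∀ x, 0 ≤ (24 * Λ / R x ^ 3 + 184 * M / R x ^ 4) * (delta M a (R x) / (R x ^ 2 + a ^ 2)) :=
    fun x ↦ by
      have := hR.pos hMa x
      exact mul_nonneg (by positivity) (hR.deriv_pos hMa x).le
  have hbot : Tendsto (fun t ↦ potDerivMajorant M Λ (R t)) atBot (𝓝 (potDerivMajorant M Λ (rPlus M a))) :=
    ((continuousAt_potDerivMajorant M Λ (hM.trans_le (M_le_rPlus M a)).ne').tendsto).comp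
      hR.tendsto_atBot
  have htop : Tendsto (fun t ↦ potDerivMajorant M Λ (R t)) atTop (𝓝 0) :=
    (tendsto_potDerivMajorant_atTop M Λ).comp hR.tendsto_atTop
  exact integrable_of_hasDerivAt_add_of_nonneg hderiv hp (integrable_zero _ _ _) continuous_const
    hbot htop

/-- `x ↦ (dV/dr)(R(x))` is continuous (`dV/dr` is an explicit rational function of `r > 0`). [folklore] -/
theorem continuous_deriv_sepPotential_comp (hR : IsTortoiseRadius M a R) (hMa : IsSubextremal M a) :
    Continuous fun x ↦ deriv (sepPotential M a ω m Λ) (R x) := by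
  have hRc := hR.continuous
  have hD : ∀ x, R x ^ 2 + a ^ 2 ≠ 0 := fun x ↦ (hR.sq_add_sq_pos hMa x).ne'
  have heq : (fun x ↦ deriv (sepPotential M a ω m Λ) (R x)) = fun x ↦
      critPoly M a ω m Λ (R x) / (R x ^ 2 + a ^ 2) ^ 3 + critPoly₁ M a (R x) / (R x ^ 2 + a ^ 2) ^ 5 := by
    funext x
    exact deriv_sepPotential_eq M a ω m Λ (hD x)
  rw [heq]
  refine Continuous.add (Continuous.div ?_ ?_ fun x ↦ pow_ne_zero 3 (hD x))
    (Continuous.div ?_ ?_ fun x ↦ pow_ne_zero 5 (hD x))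
  · unfold critPoly; fun_prop
  · fun_prop
  · unfold critPoly₁; fun_prop
  · fun_prop

/-- **`V' = (dV/dr)(R) Δ/(R² + a²)` is integrable on `ℝ`** for an admissible triple (dominated by
the derivative of `Φ ∘ R`). [folklore] -/
theorem integrable_deriv_sepPotential_comp (hR : IsTortoiseRadius M a R) (hMa : IsSubextremal M a)
    (hadm : IsAdmissibleTriple a ω m Λ) :
    Integrable fun x ↦ deriv (sepPotential M a ω m Λ) (R x) * (delta M a (R x) / (R x ^ 2 + a ^ 2)) := by
  have hM := hMa.pos
  have hΛ0 := hadm.nonneg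
  have hRc := hR.continuous
  refine (integrable_potDerivMajorant_deriv hR hMa hadm.nonneg).mono ?_ (Eventually.of_forall fun x ↦ ?_)
  · exact ((continuous_deriv_sepPotential_comp hR hMa).mul
      ((by unfold delta; fun_prop : Continuous fun x ↦ delta M a (R x)).div (by fun_prop)
        fun x ↦ (hR.sq_add_sq_pos hMa x).ne')).aestronglyMeasurable
  · have hDpos := (hR.deriv_pos hMa x).le
    have hRx := hR.pos hMa x
    have hb := abs_deriv_sepPotential_le hM (le_of_lt hMa) hadm (hR.rPlus_lt x).le
    rw [Real.norm_eq_abs, Real.norm_eq_abs, abs_mul, abs_of_nonneg hDpos,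
      abs_of_nonneg (mul_nonneg (by positivity) hDpos)]
    exact mul_le_mul_of_nonneg_right hb hDpos

end PotentialAlongR

/-! ### The objects of the main estimate along a tortoise radius function -/

/-- The splitting cut-off `k = χ₂(R)` read along `r*` (`χ₂ = 1` on `r ≤ R_a`, `0` on `r ≥ R_a + 1`;
`V_≤ = χ₂V`, `V_≥ = (1 − χ₂)V` in DRSR arXiv:1402.7034, §8.7.4). [cite: DafermosRodnianskiShlapentokhrothman2014, Prop. 8.7.4 (proof)] -/
def nsCutoff (Ra : ℝ) (R : ℝ → ℝ) (x : ℝ) : ℝ :=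
  radialCutoff (Ra + 1) (R x)

/-- The `r*`-derivative `k' = −ψ'(R_a + 1 − R) · Δ/(R² + a²)` of `k = χ₂(R)`. [folklore] -/
def nsCutoffDeriv (M a Ra : ℝ) (R : ℝ → ℝ) (x : ℝ) : ℝ :=
  -softStepDeriv (Ra + 1 - R x) * (delta M a (R x) / (R x ^ 2 + a ^ 2))

/-- The `r*`-derivative `y' = C g y` of the weight `y` (cut-off radius `R_a + 2`). [cite: DafermosRodnianskiShlapentokhrothman2014, Prop. 8.7.4 (proof)] -/
def nsWeightDeriv (C Ra X : ℝ) (R : ℝ → ℝ) (x : ℝ) : ℝ :=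
  C * nsWeightIntegrand (Ra + 2) R x * nsWeight C (Ra + 2) X R x

section CutoffLemmas

variable {M a ω Λ Λ₁ C Ra X : ℝ} {m : ℤ} {R : ℝ → ℝ}

/-- `k' ` is the derivative of `k`. [folklore] -/
theorem hasDerivAt_nsCutoff (hR : IsTortoiseRadius M a R) (Ra x : ℝ) :
    HasDerivAt (nsCutoff Ra R) (nsCutoffDeriv M a Ra R x) x :=
  (hasDerivAt_radialCutoff (Ra + 1) (R x)).comp x (hR.hasDerivAt x)

/-- `0 ≤ k ≤ 1`. [folklore] -/
theorem nsCutoff_mem_Icc (Ra : ℝ) (R : ℝ → ℝ) (x : ℝ) : nsCutoff Ra R x ∈ Icc (0 : ℝ) 1 :=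
  radialCutoff_mem_Icc _ _

/-- `k = 0` where `R ≥ R_a + 1`. [folklore] -/
theorem nsCutoff_eq_zero {Ra : ℝ} {R : ℝ → ℝ} {x : ℝ} (h : Ra + 1 ≤ R x) : nsCutoff Ra R x = 0 :=
  radialCutoff_of_ge h

/-- `k = 1` where `R ≤ R_a`. [folklore] -/
theorem nsCutoff_eq_one {Ra : ℝ} {R : ℝ → ℝ} {x : ℝ} (h : R x ≤ Ra) : nsCutoff Ra R x = 1 :=
  radialCutoff_of_le (by linarith)

/-- `|k'| ≤ 2` (`|ψ'| ≤ 2`, `0 ≤ dR/dx ≤ 1`). [folklore] -/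
theorem abs_nsCutoffDeriv_le (hR : IsTortoiseRadius M a R) (hMa : IsSubextremal M a) (Ra x : ℝ) :
    |nsCutoffDeriv M a Ra R x| ≤ 2 := by
  unfold nsCutoffDeriv
  rw [abs_mul, abs_neg, abs_of_nonneg (hR.deriv_pos hMa x).le]
  calc |softStepDeriv (Ra + 1 - R x)| * (delta M a (R x) / (R x ^ 2 + a ^ 2))
      ≤ 2 * 1 := mul_le_mul (abs_softStepDeriv_le _) (hR.deriv_le_one hMa x)
        (hR.deriv_pos hMa x).le zero_le_two
    _ = 2 := mul_one 2

/-- `k' ≠ 0` only on the transition region `R_a < R < R_a + 1`. [folklore] -/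
theorem nsCutoffDeriv_support {Ra x : ℝ} (h : nsCutoffDeriv M a Ra R x ≠ 0) :
    Ra < R x ∧ R x < Ra + 1 := by
  unfold nsCutoffDeriv at h
  have hs : softStepDeriv (Ra + 1 - R x) ≠ 0 := by
    intro h0
    rw [h0] at h
    simp at h
  constructor
  · by_contra h1
    exact hs (softStepDeriv_of_one_le (by linarith [not_lt.1 h1]))
  · by_contra h1
    exact hs (softStepDeriv_of_nonpos (by linarith [not_lt.1 h1]))

/-- `k` and `k'` are continuous. [folklore] -/
theorem continuous_nsCutoff (hR : IsTortoiseRadius M a R) (Ra : ℝ) : Continuous (nsCutoff Ra R) :=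
  (continuous_radialCutoff _).comp hR.continuous

/-- `k'` is continuous. [folklore] -/
theorem continuous_nsCutoffDeriv (hR : IsTortoiseRadius M a R) (hMa : IsSubextremal M a) (Ra : ℝ) :
    Continuous (nsCutoffDeriv M a Ra R) := by
  have hRc := hR.continuous
  unfold nsCutoffDeriv delta
  refine ((continuous_softStepDeriv.comp (by fun_prop)).neg).mul
    (Continuous.div (by fun_prop) (by fun_prop) fun x ↦ (hR.sq_add_sq_pos hMa x).ne')

/-- `y'` is the derivative of `y` (restatement of `hasDerivAt_nsWeight`). [folklore] -/
theorem hasDerivAt_nsWeight' (hR : IsTortoiseRadius M a R) (hMa : IsSubextremal M a) (x : ℝ) :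
    HasDerivAt (nsWeight C (Ra + 2) X R) (nsWeightDeriv C Ra X R x) x :=
  hasDerivAt_nsWeight hR hMa x

/-- `y'` is continuous. [folklore] -/
theorem continuous_nsWeightDeriv (hR : IsTortoiseRadius M a R) (hMa : IsSubextremal M a) :
    Continuous (nsWeightDeriv C Ra X R) :=
  (continuous_const.mul (continuous_nsWeightIntegrand hR hMa)).mul (continuous_nsWeight hR hMa)

/-- `y' ≥ 0` (for `C ≥ 0`). [folklore] -/
theorem nsWeightDeriv_nonneg (hR : IsTortoiseRadius M a R) (hMa : IsSubextremal M a) (hC : 0 ≤ C)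
    (x : ℝ) : 0 ≤ nsWeightDeriv C Ra X R x :=
  mul_nonneg (mul_nonneg hC (nsWeightIntegrand_mem_Icc hR hMa x).1) (nsWeight_pos _ _ _ _ _).le

/-- **Below the cut-off radius `y = y' R²/C ≤ y' (R_a + 1)²/C`** (`R(x) < R_a + 1`, `C > 0`).
[cite: DafermosRodnianskiShlapentokhrothman2014, Prop. 8.7.4 (proof)] -/
theorem nsWeight_le_deriv_mul (hC : 0 < C) {x : ℝ} (hx : R x < Ra + 1) (hRpos : 0 < R x) :
    nsWeight C (Ra + 2) X R x ≤ nsWeightDeriv C Ra X R x * (Ra + 1) ^ 2 / C := by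
  have hg : nsWeightIntegrand (Ra + 2) R x = 1 / R x ^ 2 := nsWeightIntegrand_of_le (by linarith)
  unfold nsWeightDeriv
  rw [hg]
  have hy := (nsWeight_pos C (Ra + 2) X R x).le
  have hR2 : 0 < R x ^ 2 := pow_pos hRpos 2
  rw [le_div_iff₀ hC]
  have h1 : R x ^ 2 ≤ (Ra + 1) ^ 2 := pow_le_pow_left₀ hRpos.le hx.le 2
  calc nsWeight C (Ra + 2) X R x * C = C * (1 / R x ^ 2) * nsWeight C (Ra + 2) X R x * R x ^ 2 := by
        field_simp
    _ ≤ C * (1 / R x ^ 2) * nsWeight C (Ra + 2) X R x * (Ra + 1) ^ 2 :=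
        mul_le_mul_of_nonneg_left h1 (by positivity)

/-- **`y'` is integrable on `ℝ`** (`∫ y' = y(∞) − y(−∞) = 1`), for `C > 0`, `R(X) ≥ R_a + 2` and
`R_a + 1 > r₊`. [folklore] -/
theorem integrable_nsWeightDeriv (hR : IsTortoiseRadius M a R) (hMa : IsSubextremal M a) (hC : 0 < C)
    (hX : Ra + 2 ≤ R X) (hRa : rPlus M a < Ra + 1) : Integrable (nsWeightDeriv C Ra X R) := by
  have hderiv : ∀ x, HasDerivAt (nsWeight C (Ra + 2) X R) (nsWeightDeriv C Ra X R x + 0) x :=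
    fun x ↦ (hasDerivAt_nsWeight' hR hMa x).congr_deriv (add_zero _).symm
  exact integrable_of_hasDerivAt_add_of_nonneg hderiv (nsWeightDeriv_nonneg hR hMa hC.le)
    (integrable_zero _ _ _) continuous_const
    (tendsto_nsWeight_atBot hR hMa hC (by linarith)) (tendsto_nsWeight_atTop hR hMa hX)

end CutoffLemmas

/-- Carter's potential read along a tortoise radius function, `V(x) = V_{(ω,m,Λ)}(R(x))`. [cite: DafermosRodnianskiShlapentokhrothman2014, §5.2.3] -/
def sepPotentialR (M a ω : ℝ) (m : ℤ) (Λ : ℝ) (R : ℝ → ℝ) (x : ℝ) : ℝ :=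
  sepPotential M a ω m Λ (R x)

/-- Its `r*`-derivative `V'(x) = (dV/dr)(R(x)) · Δ(R)/(R² + a²)`. [cite: DafermosRodnianskiShlapentokhrothman2014, §5.2.3] -/
def sepPotentialRDeriv (M a ω : ℝ) (m : ℤ) (Λ : ℝ) (R : ℝ → ℝ) (x : ℝ) : ℝ :=
  deriv (sepPotential M a ω m Λ) (R x) * (delta M a (R x) / (R x ^ 2 + a ^ 2))

section PotentialR

variable {M a ω Λ : ℝ} {m : ℤ} {R : ℝ → ℝ}

/-- `V'` is the derivative of `V` along `r*`. [cite: DafermosRodnianskiShlapentokhrothman2014, §5.2.3] -/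
theorem hasDerivAt_sepPotentialR (hR : IsTortoiseRadius M a R) (hMa : IsSubextremal M a) (x : ℝ) :
    HasDerivAt (sepPotentialR M a ω m Λ R) (sepPotentialRDeriv M a ω m Λ R x) x :=
  hasDerivAt_sepPotential_comp hR hMa x

/-- `V` along `r*` is continuous. [folklore] -/
theorem continuous_sepPotentialR (hR : IsTortoiseRadius M a R) (hMa : IsSubextremal M a) :
    Continuous (sepPotentialR M a ω m Λ R) :=
  continuous_iff_continuousAt.2 fun x ↦ (hasDerivAt_sepPotentialR hR hMa x).continuousAt

/-- `V'` along `r*` is continuous. [folklore] -/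
theorem continuous_sepPotentialRDeriv (hR : IsTortoiseRadius M a R) (hMa : IsSubextremal M a) :
    Continuous (sepPotentialRDeriv M a ω m Λ R) := by
  have hRc := hR.continuous
  unfold sepPotentialRDeriv delta
  exact (continuous_deriv_sepPotential_comp hR hMa).mul
    (Continuous.div (by fun_prop) (by fun_prop) fun x ↦ (hR.sq_add_sq_pos hMa x).ne')

end PotentialR

end Kerr

end Literature.Geometry.Lorentzian

end
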